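import Literature.NumberTheory.LFunctions.Zhang2022.Section8Lemma84Coeff
import Literature.NumberTheory.LFunctions.Zhang2022.Section8Lemma84LBounds
import Literature.NumberTheory.LFunctions.Zhang2022.Section8Lemma82
import Literature.NumberTheory.LFunctions.Zhang2022.Section8LFunctionFloor
import HarnessLib

/-!
# Zhang (2022), Lemma 8.4 — VI: the comparison on the small rectangle and the size of the
# integrand on the contour (helpers for the assembly)

Topic `Literature/NumberTheory/LFunctions/Zhang2022` (Landau–Siegel audit tree; verdict-neutral).
Y. Zhang, *Discrete mean estimates and the Landau–Siegel zero*, arXiv:2211.02515v1 (2022)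
[Zhang2022LandauSiegel] — **an unrefereed manuscript under adjudication**; DAG node `Z22:Lem8.4.pf`
[Z22 p.47, tex L2405–2418]: "By Lemma 5.5 and 5.6, for `|s| = 5α` we have
`L(1+s+β_{j+1},χ)L(1+s+β_{j+2},χ)/L(1+s,χ) = L′(1,χ)(s+β_{j+1})(s+β_{j+2})/s + O(𝓛⁻¹⁵)`. Combining
these results with Lemma 8.3, we find that the integral (8.9) is equal to `L′(1,χ)Π(d,r)·(2πi)⁻¹∮ … + O(𝓛⁻⁶)`."

This file isolates the two quantitative ingredients of that step, with explicit constants: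

* `norm_quot_sub_model_le` — the algebra of the comparison
  `𝔲·L_aL_b/L_0 − Πℓ(s+β_a)(s+β_b)/s` from `L_• = ℓ(s+β_•) + O(E)`, `L_0 = ℓs + O(E)`, `𝔲 = Π + O(E_U)`
  on a contour with `α/2 ≤ |s|`, `|s|, |s+β_•| ≤ Kα`: the error is
  `≤ |Π|E(24K² + 2K) + 32K³E_U|ℓ|α` — in particular it carries the factor `|Π(d,r)|` (resp. the
  relative factor of `E_U`), which is why the kernel statement of Lemma 8.4 has the constant
  `C·(∏_{q∣dr}(1−q⁻¹)⁻¹)²` and not an absolute `C` (GAP-LEDGER class: printed-stronger-than-proved);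
* `norm_LFunction_le_near_one` — `‖L(s,χ)‖ ≤ 2(4 + log q + log(|s|+1))` for `1 − η ≤ σ ≤ 2` when
  `η(log q + log(|s|+1)) ≤ 1/8` (the tree's `Lemma82.norm_LFunction_le_left` /
  `Section8Floor.norm_LFunction_le_right`);
* `norm_quot_le` — `‖𝔲L_aL_b L_0⁻¹‖ ≤ M_U B_L² M_inv` from the four factor bounds;
* `pow_mul_exp_neg_le`, `rpow_le_pow_natCeil` — `v^k e^{−av} ≤ k!/a^k` and `x^r ≤ x^⌈r⌉` (`x ≥ 1`), the
  elementary facts that turn `poly(𝓛)·e^{−c𝓛^{1/10}}`, `poly(𝓛)/D` into constants.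

Nothing about the manuscript's Theorems 1–2 or about Landau–Siegel zeros is asserted.

## References

* Y. Zhang, arXiv:2211.02515v1 (2022), §8 Lemma 8.4 (proof). [cite: Zhang2022LandauSiegel, §8 Lemma 8.4]
* H. L. Montgomery, R. C. Vaughan, *Multiplicative Number Theory I*, CUP 2007, Thm 4.8.
  [cite: MontgomeryVaughan2007, Thm 4.8]
-/

noncomputable section

open Complex Real

namespace Literature.NumberTheory.LFunctions.Zhang2022.Lemma84

/-! ### The comparison with the model on the small contour -/

/-- **The `O(𝓛⁻¹⁵)`-comparison of the proof of Lemma 8.4, as algebra with explicit constants.** Let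
`L_a = ℓA + e_a`, `L_b = ℓB + e_b`, `L_0 = ℓs + e_0` with `‖e_•‖ ≤ E`, `𝔲 = Π + e_u` with `‖e_u‖ ≤ E_U`,
`α/2 ≤ ‖s‖ ≤ Kα`, `‖A‖, ‖B‖ ≤ Kα` (`K ≥ 1`, `α > 0`), `0 < ℓ₀ ≤ ‖ℓ‖` and `E ≤ ℓ₀α/4`. Then
`‖𝔲L_aL_b/L_0 − ΠℓAB/s‖ ≤ ‖Π‖E(24K² + 2K) + 32K³E_U‖ℓ‖α`.
[cite: Zhang2022LandauSiegel, §8 Lemma 8.4 (proof, "By Lemma 5.5 and 5.6 …")] -/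
theorem norm_quot_sub_model_le {u La Lb L0 Pv ℓ s A B : ℂ} {E EU α K ℓ₀ : ℝ}
    (hα : 0 < α) (hK : 1 ≤ K) (hℓ₀ : 0 < ℓ₀) (hℓ : ℓ₀ ≤ ‖ℓ‖) (hE0 : 0 ≤ E) (hEU0 : 0 ≤ EU)
    (hE : E ≤ ℓ₀ * α / 4)
    (ha : ‖La - ℓ * A‖ ≤ E) (hb : ‖Lb - ℓ * B‖ ≤ E) (h0 : ‖L0 - ℓ * s‖ ≤ E) (hu : ‖u - Pv‖ ≤ EU)
    (hs : α / 2 ≤ ‖s‖) (hs' : ‖s‖ ≤ K * α) (hA : ‖A‖ ≤ K * α) (hB : ‖B‖ ≤ K * α) :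
    ‖u * La * Lb / L0 - Pv * ℓ * A * B / s‖ ≤
      ‖Pv‖ * E * (24 * K ^ 2 + 2 * K) + 32 * K ^ 3 * EU * ‖ℓ‖ * α := by
  -- names for the perturbations
  set ea := La - ℓ * A with hea
  set eb := Lb - ℓ * B with heb
  set e0 := L0 - ℓ * s with he0
  set eu := u - Pv with heu
  have hℓpos : 0 < ‖ℓ‖ := lt_of_lt_of_le hℓ₀ hℓ
  have hs0 : 0 < ‖s‖ := lt_of_lt_of_le (by positivity) hs
  have hsne : s ≠ 0 := norm_pos_iff.1 hs0
  -- `‖L0‖ ≥ ‖ℓ‖ α / 4`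
  have hEℓ : E ≤ ‖ℓ‖ * α / 4 := hE.trans (by gcongr)
  have hL0 : ‖ℓ‖ * α / 4 ≤ ‖L0‖ := by
    have h1 : ‖ℓ * s‖ - ‖e0‖ ≤ ‖L0‖ := by
      have := norm_sub_norm_le (ℓ * s) (ℓ * s - L0)
      rw [sub_sub_cancel, norm_sub_rev (ℓ * s) L0] at this
      linarith
    have h2 : ‖ℓ‖ * (α / 2) ≤ ‖ℓ * s‖ := by rw [norm_mul]; gcongr
    linarith [h0]
  have hL0pos : 0 < ‖L0‖ := lt_of_lt_of_le (by positivity) hL0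
  have hL0ne : L0 ≠ 0 := norm_pos_iff.1 hL0pos
  -- the numerator
  have hnum_eq : u * La * Lb / L0 - Pv * ℓ * A * B / s =
      (Pv * (ℓ * A * eb * s + ea * ℓ * B * s + ea * eb * s - ℓ * A * B * e0) +
        eu * (ℓ * A + ea) * (ℓ * B + eb) * s) / (L0 * s) := by
    have hLa : La = ℓ * A + ea := by rw [hea]; ring
    have hLb : Lb = ℓ * B + eb := by rw [heb]; ring
    have hL0' : L0 = ℓ * s + e0 := by rw [he0]; ring
    have hu' : u = Pv + eu := by rw [heu]; ring
    rw [div_sub_div _ _ hL0ne hsne]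
    congr 1
    rw [hLa, hLb, hu']
    conv_lhs => rw [hL0']
    ring
  rw [hnum_eq, norm_div, norm_mul]
  rw [div_le_iff₀ (mul_pos hL0pos hs0)]
  -- bounds on the pieces
  have hKα : 0 ≤ K * α := by positivity
  have hea' : ‖ea‖ ≤ E := ha
  have heb' : ‖eb‖ ≤ E := hb
  have he0' : ‖e0‖ ≤ E := h0
  have heu' : ‖eu‖ ≤ EU := hu
  have h1 : ‖ℓ * A * eb * s‖ ≤ ‖ℓ‖ * (K * α) * E * (K * α) := by
    rw [norm_mul, norm_mul, norm_mul]; gcongr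
  have h2 : ‖ea * ℓ * B * s‖ ≤ E * ‖ℓ‖ * (K * α) * (K * α) := by
    rw [norm_mul, norm_mul, norm_mul]; gcongr
  have h3 : ‖ea * eb * s‖ ≤ E * E * (K * α) := by
    rw [norm_mul, norm_mul]; gcongr
  have h4 : ‖ℓ * A * B * e0‖ ≤ ‖ℓ‖ * (K * α) * (K * α) * E := by
    rw [norm_mul, norm_mul, norm_mul]; gcongr
  have h5 : ‖eu * (ℓ * A + ea) * (ℓ * B + eb) * s‖ ≤
      EU * (‖ℓ‖ * (K * α) + E) * (‖ℓ‖ * (K * α) + E) * (K * α) := by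
    rw [norm_mul, norm_mul, norm_mul]
    gcongr
    · calc ‖ℓ * A + ea‖ ≤ ‖ℓ * A‖ + ‖ea‖ := norm_add_le _ _
        _ ≤ ‖ℓ‖ * (K * α) + E := by rw [norm_mul]; gcongr
    · calc ‖ℓ * B + eb‖ ≤ ‖ℓ * B‖ + ‖eb‖ := norm_add_le _ _
        _ ≤ ‖ℓ‖ * (K * α) + E := by rw [norm_mul]; gcongr
  have hPPv : ‖Pv * (ℓ * A * eb * s + ea * ℓ * B * s + ea * eb * s - ℓ * A * B * e0)‖ ≤
      ‖Pv‖ * (3 * ‖ℓ‖ * K ^ 2 * α ^ 2 * E + E ^ 2 * K * α) := by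
    rw [norm_mul]
    gcongr
    calc ‖ℓ * A * eb * s + ea * ℓ * B * s + ea * eb * s - ℓ * A * B * e0‖
        ≤ ‖ℓ * A * eb * s‖ + ‖ea * ℓ * B * s‖ + ‖ea * eb * s‖ + ‖ℓ * A * B * e0‖ := by
          refine (norm_sub_le _ _).trans ?_
          gcongr
          exact (norm_add_le _ _).trans (by gcongr; exact norm_add_le _ _)
      _ ≤ _ := by linarith [h1, h2, h3, h4]
  have htot : ‖Pv * (ℓ * A * eb * s + ea * ℓ * B * s + ea * eb * s - ℓ * A * B * e0) +
      eu * (ℓ * A + ea) * (ℓ * B + eb) * s‖ ≤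
      ‖Pv‖ * (3 * ‖ℓ‖ * K ^ 2 * α ^ 2 * E + E ^ 2 * K * α) +
        EU * (‖ℓ‖ * (K * α) + E) * (‖ℓ‖ * (K * α) + E) * (K * α) :=
    (norm_add_le _ _).trans (add_le_add hPPv h5)
  refine htot.trans ?_
  -- compare with the claimed bound times `‖L0‖‖s‖ ≥ (‖ℓ‖α/4)(α/2)`
  have hden : ‖ℓ‖ * α / 4 * (α / 2) ≤ ‖L0‖ * ‖s‖ := mul_le_mul hL0 hs (by positivity) hL0pos.le
  have hPv0 : 0 ≤ ‖Pv‖ := norm_nonneg _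
  have hEℓ' : E ≤ ‖ℓ‖ * (K * α) := by
    calc E ≤ ‖ℓ‖ * α / 4 := hEℓ
      _ ≤ ‖ℓ‖ * (K * α) := by nlinarith
  -- target: RHS * (‖L0‖‖s‖) ≥ RHS * (‖ℓ‖α²/8) ≥ numerator bound
  have hR0 : 0 ≤ ‖Pv‖ * E * (24 * K ^ 2 + 2 * K) + 32 * K ^ 3 * EU * ‖ℓ‖ * α := by positivity
  calc ‖Pv‖ * (3 * ‖ℓ‖ * K ^ 2 * α ^ 2 * E + E ^ 2 * K * α) +
        EU * (‖ℓ‖ * (K * α) + E) * (‖ℓ‖ * (K * α) + E) * (K * α)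
      ≤ (‖Pv‖ * E * (24 * K ^ 2 + 2 * K) + 32 * K ^ 3 * EU * ‖ℓ‖ * α) *
          (‖ℓ‖ * α / 4 * (α / 2)) := by
        -- piece 1: `‖Pv‖·3‖ℓ‖K²α²E = ‖Pv‖E·24K² · ‖ℓ‖α²/8`
        -- piece 2: `‖Pv‖·E²Kα ≤ ‖Pv‖E·2K · ‖ℓ‖α²/8` (`E ≤ ‖ℓ‖α/4`)
        -- piece 3: `EU(‖ℓ‖Kα+E)²Kα ≤ 32K³EU‖ℓ‖α · ‖ℓ‖α²/8` (`‖ℓ‖Kα + E ≤ 2‖ℓ‖Kα`)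
        have p2 : E ^ 2 * K * α ≤ E * (2 * K) * (‖ℓ‖ * α / 4 * (α / 2)) := by
          have h' : E * E ≤ E * (‖ℓ‖ * α / 4) := mul_le_mul_of_nonneg_left hEℓ hE0
          have h'' := mul_le_mul_of_nonneg_right h' hKα
          calc E ^ 2 * K * α = E * E * (K * α) := by ring
            _ ≤ E * (‖ℓ‖ * α / 4) * (K * α) := h''
            _ = E * (2 * K) * (‖ℓ‖ * α / 4 * (α / 2)) := by ring
        have p3 : EU * (‖ℓ‖ * (K * α) + E) * (‖ℓ‖ * (K * α) + E) * (K * α) ≤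
            32 * K ^ 3 * EU * ‖ℓ‖ * α * (‖ℓ‖ * α / 4 * (α / 2)) := by
          have hsum : ‖ℓ‖ * (K * α) + E ≤ 2 * (‖ℓ‖ * (K * α)) := by linarith
          have hsum0 : 0 ≤ ‖ℓ‖ * (K * α) + E := by positivity
          have hsq : (‖ℓ‖ * (K * α) + E) * (‖ℓ‖ * (K * α) + E) ≤
              (2 * (‖ℓ‖ * (K * α))) * (2 * (‖ℓ‖ * (K * α))) :=
            mul_le_mul hsum hsum hsum0 (by positivity)
          calc EU * (‖ℓ‖ * (K * α) + E) * (‖ℓ‖ * (K * α) + E) * (K * α)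
              = EU * ((‖ℓ‖ * (K * α) + E) * (‖ℓ‖ * (K * α) + E)) * (K * α) := by ring
            _ ≤ EU * ((2 * (‖ℓ‖ * (K * α))) * (2 * (‖ℓ‖ * (K * α)))) * (K * α) := by gcongr
            _ = 32 * K ^ 3 * EU * ‖ℓ‖ * α * (‖ℓ‖ * α / 4 * (α / 2)) := by ring
        have p1 : ‖Pv‖ * (3 * ‖ℓ‖ * K ^ 2 * α ^ 2 * E + E ^ 2 * K * α) ≤
            ‖Pv‖ * E * (24 * K ^ 2 + 2 * K) * (‖ℓ‖ * α / 4 * (α / 2)) := by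
          have : 3 * ‖ℓ‖ * K ^ 2 * α ^ 2 * E + E ^ 2 * K * α ≤
              E * (24 * K ^ 2 + 2 * K) * (‖ℓ‖ * α / 4 * (α / 2)) := by
            have e1 : E * (24 * K ^ 2 + 2 * K) * (‖ℓ‖ * α / 4 * (α / 2)) =
                3 * ‖ℓ‖ * K ^ 2 * α ^ 2 * E + E * (2 * K) * (‖ℓ‖ * α / 4 * (α / 2)) := by ring
            rw [e1]; linarith [p2]
          calc ‖Pv‖ * (3 * ‖ℓ‖ * K ^ 2 * α ^ 2 * E + E ^ 2 * K * α)
              ≤ ‖Pv‖ * (E * (24 * K ^ 2 + 2 * K) * (‖ℓ‖ * α / 4 * (α / 2))) :=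
                mul_le_mul_of_nonneg_left this hPv0
            _ = _ := by ring
        linarith [p1, p3]
    _ ≤ (‖Pv‖ * E * (24 * K ^ 2 + 2 * K) + 32 * K ^ 3 * EU * ‖ℓ‖ * α) * (‖L0‖ * ‖s‖) :=
        mul_le_mul_of_nonneg_left hden hR0

/-! ### `L(s,χ)` near the line `σ = 1` -/

/-- **`‖L(s,χ)‖ ≤ 2(4 + log q + log(|s|+1))` for `1 − η ≤ σ`** when `η ≤ 1/2` and
`η(log q + log(|s|+1)) ≤ 1/8` (left of `1`: the tree's `Lemma82.norm_LFunction_le_left` with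
`(q(|s|+1))^{1−σ} ≤ e^{1/8} ≤ 2`; right of `1`: `Section8Floor.norm_LFunction_le_right`).
[cite: MontgomeryVaughan2007, Thm 4.8] -/
theorem norm_LFunction_le_near_one {q : ℕ} [NeZero q] (χ : DirichletCharacter ℂ q) (hχ : χ ≠ 1)
    {s : ℂ} {η : ℝ} (hη2 : η ≤ 1 / 2) (hre : 1 - η ≤ s.re)
    (hηℒ : η * (Real.log q + Real.log (‖s‖ + 1)) ≤ 1 / 8) :
    ‖χ.LFunction s‖ ≤ 2 * (4 + Real.log q + Real.log (‖s‖ + 1)) := by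
  have hq0 : (0 : ℝ) < q := by exact_mod_cast NeZero.pos q
  have hq1 : (1 : ℝ) ≤ q := by exact_mod_cast NeZero.one_le
  have hlogq : 0 ≤ Real.log q := Real.log_nonneg hq1
  have hlogs : 0 ≤ Real.log (‖s‖ + 1) := Real.log_nonneg (by linarith [norm_nonneg s])
  rcases le_or_gt s.re 1 with hs1 | hs1
  · have h := Lemma82.norm_LFunction_le_left χ hχ (by linarith) hs1
    refine h.trans ?_
    have hpow : ((q : ℝ) * (‖s‖ + 1)) ^ (1 - s.re) ≤ 2 := by
      have hbase : 0 < (q : ℝ) * (‖s‖ + 1) := by positivity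
      rw [Real.rpow_def_of_pos hbase, Real.log_mul hq0.ne' (by positivity)]
      have h1 : (Real.log q + Real.log (‖s‖ + 1)) * (1 - s.re) ≤ 1 / 8 := by
        calc (Real.log q + Real.log (‖s‖ + 1)) * (1 - s.re)
            ≤ (Real.log q + Real.log (‖s‖ + 1)) * η :=
              mul_le_mul_of_nonneg_left (by linarith) (by positivity)
          _ ≤ 1 / 8 := by linarith
      have h2 : Real.exp (1 / 8) ≤ 2 := by
        have h := Real.abs_exp_sub_one_sub_id_le (x := 1 / 8) (by norm_num)
        have h' := (abs_le.1 h).2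
        linarith
      exact (Real.exp_le_exp.2 h1).trans h2
    have hfac : 0 ≤ 4 + Real.log q + Real.log (‖s‖ + 1) := by linarith
    exact mul_le_mul_of_nonneg_right hpow hfac
  · have h := Section8Floor.norm_LFunction_le_right χ hχ hs1.le
    linarith

/-- The four-factor bound `‖𝔲L_aL_bL_0⁻¹‖ ≤ M_U·B_L·B_L·M_inv`. [cite: Zhang2022LandauSiegel, §8 Lemma 8.4] -/
theorem norm_quot_le {u La Lb L0 : ℂ} {MU BL Minv : ℝ} (hMU : 0 ≤ MU) (hBL : 0 ≤ BL)
    (hu : ‖u‖ ≤ MU) (ha : ‖La‖ ≤ BL) (hb : ‖Lb‖ ≤ BL) (h0 : ‖L0⁻¹‖ ≤ Minv) :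
    ‖u * La * Lb / L0‖ ≤ MU * BL * BL * Minv := by
  rw [div_eq_mul_inv, norm_mul, norm_mul, norm_mul]
  have : 0 ≤ MU * BL := mul_nonneg hMU hBL
  gcongr

/-! ### Exponentials beat powers -/

/-- `v^k e^{−av} ≤ k!/a^k` for `a > 0`, `v ≥ 0` (from `x^k/k! ≤ e^x` at `x = av`) — the form of
"`x^{−1/𝓛} ≤ exp(−𝓛^{0.1}) = O(ε₁)`, `O(ε₁)𝓛^C = O(𝓛⁻⁶)`" in the proofs of Lemmas 8.2/8.4.
[cite: Zhang2022LandauSiegel, §8 Lemmas 8.2 and 8.4 (the `O(ε₁)` step)] -/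
theorem pow_mul_exp_neg_le {a v : ℝ} (ha : 0 < a) (hv : 0 ≤ v) (k : ℕ) :
    v ^ k * Real.exp (-(a * v)) ≤ (k.factorial : ℝ) / a ^ k := by
  have h := Real.pow_div_factorial_le_exp (x := a * v) (by positivity) k
  have hf : (0 : ℝ) < k.factorial := by positivity
  have hak : 0 < a ^ k := pow_pos ha k
  rw [div_le_iff₀ hf] at h
  rw [le_div_iff₀ hak, Real.exp_neg]
  have hexp := Real.exp_pos (a * v)
  calc v ^ k * (Real.exp (a * v))⁻¹ * a ^ k = (a * v) ^ k * (Real.exp (a * v))⁻¹ := by ring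
    _ ≤ (Real.exp (a * v) * k.factorial) * (Real.exp (a * v))⁻¹ := by gcongr
    _ = k.factorial := by field_simp

/-- `L^m e^{−aL^{1/10}} ≤ (10m)!/a^{10m}` for `L ≥ 0`, `a > 0` (substitute `v = L^{1/10}`).
[cite: Zhang2022LandauSiegel, §8 Lemmas 8.2 and 8.4 (the `O(ε₁)` step)] -/
theorem pow_mul_exp_neg_tenth_le {a L : ℝ} (ha : 0 < a) (hL : 0 ≤ L) (m : ℕ) :
    L ^ m * Real.exp (-(a * L ^ (1 / 10 : ℝ))) ≤ ((10 * m).factorial : ℝ) / a ^ (10 * m) := by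
  set v : ℝ := L ^ (1 / 10 : ℝ) with hv
  have hv0 : 0 ≤ v := Real.rpow_nonneg hL _
  have hLv : L = v ^ 10 := by
    rw [hv, ← Real.rpow_natCast, ← Real.rpow_mul hL]; norm_num
  have hLm : L ^ m = v ^ (10 * m) := by rw [hLv, ← pow_mul]
  rw [hLm]
  exact pow_mul_exp_neg_le ha hv0 (10 * m)

/-- `x^r ≤ x^⌈r⌉` for `x ≥ 1`, `r ≥ 0` (real vs natural exponent). [folklore] -/
private theorem rpow_le_pow_natCeil {x : ℝ} (r : ℝ) (hx : 1 ≤ x) :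
    x ^ r ≤ x ^ (⌈r⌉₊ : ℕ) := by
  rw [← Real.rpow_natCast]
  exact Real.rpow_le_rpow_of_exponent_le hx (Nat.le_ceil r)

/-- **The Euler-product factor is at most a power of `𝓛`**: with `𝓛 = log D ≥ 1`, `C ≥ 0` and
`m = ⌈2C⌉`, `exp(2C(log(2𝓛)+4) + 4C𝓛⁹/D²) ≤ e^{8C + 4C·9!/2⁹}·2^m·𝓛^m` (`D = e^{𝓛}`,
`𝓛⁹e^{−2𝓛} ≤ 9!/2⁹`). [cite: Zhang2022LandauSiegel, §8 Lemma 8.3 (the factor `c∏(1+cq^{−σ})`)] -/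
theorem frakM_le {D : ℕ} {C : ℝ} (hC : 0 ≤ C) (h𝓛 : 1 ≤ Real.log D) :
    Real.exp (2 * C * (Real.log (2 * Real.log D) + 4) + 4 * C * Real.log D ^ 9 / (D : ℝ) ^ 2) ≤
      Real.exp (8 * C + 4 * C * ((Nat.factorial 9 : ℝ) / 2 ^ 9)) * 2 ^ ⌈2 * C⌉₊ *
        Real.log D ^ ⌈2 * C⌉₊ := by
  set 𝓛 : ℝ := Real.log D with h𝓛def
  have h𝓛0 : 0 < 𝓛 := by linarith
  have hD0 : (0 : ℝ) < D := by
    rcases lt_or_ge 0 (D : ℝ) with h | h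
    · exact h
    · have : Real.log (D : ℝ) ≤ 0 := by
        have : (D : ℝ) = 0 := le_antisymm h (Nat.cast_nonneg D)
        rw [this, Real.log_zero]
      linarith
  have hDexp : (D : ℝ) = Real.exp 𝓛 := by rw [h𝓛def, Real.exp_log hD0]
  -- `𝓛⁹/D² ≤ 9!/2⁹`
  have hfrac : 𝓛 ^ 9 / (D : ℝ) ^ 2 ≤ (Nat.factorial 9 : ℝ) / 2 ^ 9 := by
    rw [hDexp, ← Real.exp_nat_mul, div_eq_mul_inv, ← Real.exp_neg]
    have := pow_mul_exp_neg_le (a := 2) (by norm_num) h𝓛0.le 9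
    convert this using 2
    push_cast; ring_nf
  -- `exp(2C log(2𝓛)) = (2𝓛)^{2C} ≤ (2𝓛)^m = 2^m 𝓛^m`
  have h2𝓛 : (1 : ℝ) ≤ 2 * 𝓛 := by linarith
  have hpow : Real.exp (2 * C * Real.log (2 * 𝓛)) ≤ 2 ^ ⌈2 * C⌉₊ * 𝓛 ^ ⌈2 * C⌉₊ := by
    have heq : Real.exp (2 * C * Real.log (2 * 𝓛)) = (2 * 𝓛) ^ (2 * C) := by
      rw [Real.rpow_def_of_pos (by linarith), mul_comm]
    rw [heq, ← mul_pow]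
    exact rpow_le_pow_natCeil (2 * C) h2𝓛
  have hsplit : 2 * C * (Real.log (2 * 𝓛) + 4) + 4 * C * 𝓛 ^ 9 / (D : ℝ) ^ 2 =
      (8 * C + 4 * C * (𝓛 ^ 9 / (D : ℝ) ^ 2)) + 2 * C * Real.log (2 * 𝓛) := by ring
  have h1 : Real.exp (8 * C + 4 * C * (𝓛 ^ 9 / (D : ℝ) ^ 2)) ≤
      Real.exp (8 * C + 4 * C * ((Nat.factorial 9 : ℝ) / 2 ^ 9)) :=
    Real.exp_le_exp.2 (by nlinarith [hfrac, hC])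
  calc Real.exp (2 * C * (Real.log (2 * 𝓛) + 4) + 4 * C * 𝓛 ^ 9 / (D : ℝ) ^ 2)
      = Real.exp (8 * C + 4 * C * (𝓛 ^ 9 / (D : ℝ) ^ 2)) * Real.exp (2 * C * Real.log (2 * 𝓛)) := by
        rw [hsplit, Real.exp_add]
    _ ≤ Real.exp (8 * C + 4 * C * ((Nat.factorial 9 : ℝ) / 2 ^ 9)) *
        (2 ^ ⌈2 * C⌉₊ * 𝓛 ^ ⌈2 * C⌉₊) :=
        mul_le_mul h1 hpow (Real.exp_pos _).le (Real.exp_pos _).le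
    _ = _ := by ring


end Literature.NumberTheory.LFunctions.Zhang2022.Lemma84
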